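/-
Δ2 BRIDGE — RE-KEY (branch (c-S.1): the dictionary re-keyed at Liu's uniformising `τ′ = ῑ₁`, coordinator VERDICT 2026-08-23 21:28Z, T-SIGN =
MIRROR 21:37Z) — THE Ω-PIN OVER AN ARBITRARY TAIL.  Group (b) `σ ∕ hσ ∕ e ∕ he` of the pin signatures is carried by the μ-UNIFORM Weil
carriers of record at `δ′ = (2δ_F)⁻¹` (`Model.uniformOmegaRep … (2 * imagUnit F)⁻¹ (fun _ _ ↦ r)`, ✔ `Item6UniformOmegaRep.lean` p370765) and
does NOT read the tail `t : RestTail C μ hμ` ([Liu2021] Def. 4.5 (2) ∕ 4.16 ∕ Rem. 4.17: `D_μ`, `A_μ`, `Ω(μ)`, `res` — the CM-side fields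
carrying the PRESENTATION EMBEDDING of `A_μ ⊗_{E,τ′} ℂ`): `(toThm418Data C (U.rest t)).AdmIndex ∕ .omegaAt ∕ .rhoAt` unfold to `U` and `μ`
only (`Prop413DataOfTower.lean` :107–125).  ✔ `D2Bridge/OmegaPinAtDeltaPrime.lean` (p371714) pins the rest by `hR : restOfCharDeltaPrime … = R`,
i.e. to the `ι₁`-PRESENTED one-object tail (`Model.restOfCharRep := restOne C (AlgHom.id ℚ F) ι₁ … (PolDR ι₁ … (RMuForm ι₁ …)) … (rhoΩOne … ι₁ …)`,
`Item6RestOfCharRep.lean` :79–101); the re-keyed composition reads ONE rest per line for (a)(b)(c)(d) whose (d) pieces live, BY VALUE, on the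
`ῑ₁`-presented tail `restTailOne (AlgHom.id ℚ L) ῑ₁ hμ hw Car (rhoΩOne … ῑ₁ …)` (prove-3's `nonempty_hcmPieces_atLiuDictionaryPin (ιg := ῑ₁)`,
instance `algebraMap = ῑ₁` where prove-5's `J` lives; S1 ✔ `D2Bridge.exists_dLiu_of_objOne` run verbatim at `ῑ₁` meets `adm′ = IsReflexOfTypeG ῑ₁ Φ_μ`).
This file restates prove-6's two theorems with `hR : (uniformOmegaRep … (2 * imagUnit F)⁻¹ (fun _ _ ↦ r)).rest t = R` (ANY tail; at the
`ι₁`-tail this is ✔ `Model.restOfCharRep_eq_rest`, `rfl`, so p371714 is the special case) and re-derives the `hnvD` reading and `𝒜(μ) ≠ ∅` for the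
tail presented at any `σ : F →+* ℂ`.  The witnesses are F4's (p370447): Def. 4.12's `e₀ := (r ε)·(2δ_F)⁻¹` under the δ-positivity `hΦ` of `Φ_μ`
at the line scalar ([Def 4.12] «Im τ′(e) < 0 on Φ_μ» FORCES `Φ_μ = Φ^δ(a)` — T-SIGN = MIRROR, `OmegaPinTSign.lean`), and `Submodule.quotEquivOfEq`
of the twin coinvariant quotients ([GR91] Prop. 3.1.1).  Seat prover-pub-hodgecm2-d2bridge-prove-4-g2-0 (F4 author lineage).  THEOREMS ONLY; no
definition, no named fact, no instance, no `variable`; nothing landed is edited or restated beyond the re-typing over `U.rest t`.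
HC_CM is NOT proved; «Δ2 BRIDGE CLOSED» is NOT claimed; `hD1`, `h21` are hypotheses of theorems; hLiu = READING r8; no pointer moves.
-/
import Summits.HodgeConjecture.CorCM.B01.Transposition.Item6UniformOmegaRep
import Summits.HodgeConjecture.CorCM.B01.Transposition.Item6OmegaTransportCenter
import Summits.HodgeConjecture.HodgeCM.Model.WeilCentralCoinvariants_2
import Summits.HodgeConjecture.HodgeCM.Model.LiuDictionaryInstance
import Literature.NumberTheory.Automorphic.Liu2021.AppendixC.Prop413DataOfRestOne
import HarnessLib

set_option autoImplicit false

/-!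
# The Ω-pin at `δ′ = (2δ_F)⁻¹` over the uniform carriers of record and ANY tail `t`

* §1 readings over `(uniformOmegaRep … (2 * imagUnit F)⁻¹ (fun _ _ ↦ r)).rest t`: `rhoAt_restAtDeltaPrimeTail_smooth`,
  `rhoAt_restAtDeltaPrimeTail_isIrreducible_of_lemD1AsPrinted`, `nontrivial_omegaAt_restAtDeltaPrimeTail_of_lemD1AsPrinted` (the `hnvD` pin);
* §2 `Model.exists_omegaPin_line_tail` — ONE line, loose fields, ANY tail: `∃ σ (hσ) e, (equivariance)`;
* §3 `Model.exists_omegaPin_tail` — THE FAMILY FORM over `line : Char → HodgeCM.Model.SplitLine (diagonal dV) …` with per-line tails `t i hφ hg`;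
* §4 `nonempty_obj_rest_restTailOne (σ) (h21)` — `𝒜(μ) ≠ ∅` for the one-object tail presented at ANY `σ : F →+* ℂ` ([Shimura1998] Thm. 21.4).
HC_CM is NOT proved.
-/

noncomputable section

open scoped TensorProduct Matrix

namespace Summit.HodgeConjecture.CorCM.Model

open CategoryTheory CategoryTheory.Limits AlgebraicGeometry NumberField IsDedekindDomain
open Literature.AlgebraicGeometry.Motives Literature.AlgebraicGeometry.HodgeTheory Literature.AlgebraicGeometry.ShimuraVarieties
open Literature.AlgebraicGeometry.ShimuraVarieties.UnitaryCanonicalModel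
open Literature.AlgebraicGeometry.Liu2021 (IsAdmissibleElement)
open Literature.NumberTheory.ComplexMultiplication Literature.NumberTheory.Automorphic
open Literature.NumberTheory.Automorphic.IdeleClassGroup Literature.NumberTheory.Automorphic.PicardCM
open Literature.NumberTheory.Automorphic.Liu2021 Literature.NumberTheory.Automorphic.Liu2021.AppendixC
open Literature.NumberTheory.Automorphic.Liu2021.AppendixC.RestOne
open Literature.NumberTheory.Automorphic.Liu2021.Def411WeilCarriers (JW TW isSymm_TW isUnit_det_TW JW_eq JW_apply_ne_zero locF lineOf Rep
  Eps Chi epsOf omegaAtLine rhoAtLine rhoVAtLine lineChar)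
open Literature.NumberTheory.GelbartRogawski1991 Literature.NumberTheory.GelbartRogawski1991.UnitaryDualPair
open Literature.NumberTheory.GelbartRogawski1991.UnitaryDualPair.LocalSplitting (localMu norm_localMu continuous_localMu localMu_toLocalRing_eq_one_iff)
open Literature.NumberTheory.Weil1964 Literature.RepresentationTheory Literature.RepresentationTheory.Liu2021
open Summit.HodgeConjecture.CorCM.Transposition
open Summit.HodgeConjecture.CorCM.Transposition.OmegaTransport
/-! ## §1 The Weil-side readings over any tail -/

section Rest

/-- **smoothness** at the δ′ carriers over any tail (`rhoAtLine_smooth` + `hscChiD`, `ιV` continuous). [cite: Liu2021, Def. 4.11 (FJcycle.tex l. 2094–2096)] -/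
theorem rhoAt_restAtDeltaPrimeTail_smooth (h : exists_recordSystem) (F : CMField) [IsGalois ℚ F]
    (ι₁ : F →+* ℂ) (V : HermSpace3 F ι₁) (Φ : CMType F) {n : ℕ} (e : Fin 3 × Fin 1 ≃ Fin n) (dV : Fin 3 → F)
    (hdV : ∀ i, IsCMField.complexConj F (dV i) = dV i) (hdV0 : ∀ i, dV i ≠ 0)
    (ιV : (sec42DataOf h isoOf F ι₁ V Φ).G →*
      UnitaryGroup.finAdelic ↥(maximalRealSubfield F) F (IsCMField.complexConj F) 3 (Matrix.diagonal dV))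
    (r : Rep ↥(maximalRealSubfield F) (imagUnitSq F))
    (μ : Literature.NumberTheory.Automorphic.IdeleClassGroup F →ₜ* Circle) (hμ : IdeleClassGroup.IsConjugateSymplectic F μ)
    (t : RestTail (sec42DataOf h isoOf F ι₁ V Φ) μ hμ) (hιc : Continuous ιV)
    (i : (toThm418Data (sec42DataOf h isoOf F ι₁ V Φ) ((uniformOmegaRep h F ι₁ V Φ e dV hdV hdV0 ιV (2 * imagUnit F)⁻¹ (fun _ _ => r)).rest t)).AdmIndex)
    (v : (toThm418Data (sec42DataOf h isoOf F ι₁ V Φ) ((uniformOmegaRep h F ι₁ V Φ e dV hdV hdV0 ιV (2 * imagUnit F)⁻¹ (fun _ _ => r)).rest t)).omegaAt i) :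
    ∃ S : Subgroup (sec42DataOf h isoOf F ι₁ V Φ).G, IsOpen (S : Set (sec42DataOf h isoOf F ι₁ V Φ).G) ∧
      ∀ k ∈ S, (toThm418Data (sec42DataOf h isoOf F ι₁ V Φ) ((uniformOmegaRep h F ι₁ V Φ e dV hdV hdV0 ιV (2 * imagUnit F)⁻¹ (fun _ _ => r)).rest t)).rhoAt i k v = v :=
  Def411WeilCarriers.rhoAtLine_smooth ↥(maximalRealSubfield F) F (IsCMField.complexConj F) 3 e (Matrix.diagonal dV)
    (complexConj_imagUnit F) (imagUnit_ne_zero F) (imagUnit_mul_self F) (realDiagonal_isSymm F dV hdV)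
    (isUnit_det_realDiagonal F dV hdV hdV0) (realDiagonal_map F dV hdV).symm
    (OmegaChiSplitting.hsChiD F e dV hdV hdV0 (toHeckeCharacter F μ) (isUnitary_toHeckeCharacter F μ)
      ((isOscillatorChar_toHeckeCharacter_iff μ).mpr hμ))
    ιV hιc
    (OmegaChiSplitting.hscChiD F e dV hdV hdV0 (toHeckeCharacter F μ) (isUnitary_toHeckeCharacter F μ)
      ((isOscillatorChar_toHeckeCharacter_iff μ).mpr hμ)) (r.toFun i.1.1) i.1.2 v

/-- **irreducibility** at the δ′ carriers over any tail, from [Liu2021, App. D Lemma D.1 (1)] AS PRINTED per place at the `μ`-attached local data ON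
THE LINE `⟨r ε⟩` (`chiLocalSplittingsD … (r.toFun ε)`, `localMu F (toHeckeCharacter F μ)`; hypothesis `hD1`), `ιV` onto, `3 ≤ n` — `rhoAtLine_isIrreducible_of_lemD1AsPrinted`
with `hfac := hfac_sChiD … (r.toFun ε)`; survival and unitarity are theorems.
[cite: Liu2021, Def. 4.11 (FJcycle.tex l. 2090–2096), App. D §D.1 Steps 1∕2∕3 (l. 5217∕5219∕5221), Lemma D.1 (l. 5227; (1) l. 5229)]
[cite: GelbartRogawski1991, §3.1 Prop. 3.1.1 p. 455 L1–3, Remark p. 457 L4–13] -/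
theorem rhoAt_restAtDeltaPrimeTail_isIrreducible_of_lemD1AsPrinted (h : exists_recordSystem) (F : CMField) [IsGalois ℚ F]
    (ι₁ : F →+* ℂ) (V : HermSpace3 F ι₁) (Φ : CMType F) {n : ℕ} (e : Fin 3 × Fin 1 ≃ Fin n) (dV : Fin 3 → F)
    (hdV : ∀ i, IsCMField.complexConj F (dV i) = dV i) (hdV0 : ∀ i, dV i ≠ 0)
    (ιV : (sec42DataOf h isoOf F ι₁ V Φ).G →*
      UnitaryGroup.finAdelic ↥(maximalRealSubfield F) F (IsCMField.complexConj F) 3 (Matrix.diagonal dV))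
    (r : Rep ↥(maximalRealSubfield F) (imagUnitSq F))
    (μ : Literature.NumberTheory.Automorphic.IdeleClassGroup F →ₜ* Circle) (hμ : IdeleClassGroup.IsConjugateSymplectic F μ)
    (t : RestTail (sec42DataOf h isoOf F ι₁ V Φ) μ hμ)
    (hιs : Function.Surjective ιV) (hn : 3 ≤ n)
    (i : (toThm418Data (sec42DataOf h isoOf F ι₁ V Φ) ((uniformOmegaRep h F ι₁ V Φ e dV hdV hdV0 ιV (2 * imagUnit F)⁻¹ (fun _ _ => r)).rest t)).AdmIndex)
    (hD1 : ∀ v : HeightOneSpectrum (𝓞 ↥(maximalRealSubfield F)), LemD1_1AsPrinted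
      (Def411WeilCarriers.localLemD1Data ↥(maximalRealSubfield F) F (IsCMField.complexConj F) 3 e (Matrix.diagonal dV)
        (complexConj_imagUnit F) (imagUnit_ne_zero F) (imagUnit_mul_self F) (realDiagonal_isSymm F dV hdV)
        (isUnit_det_realDiagonal F dV hdV hdV0) (realDiagonal_map F dV hdV).symm (r.toFun i.1.1)
        (OmegaChiSplitting.chiLocalSplittingsD F e dV hdV hdV0 (toHeckeCharacter F μ) ((isOscillatorChar_toHeckeCharacter_iff μ).mpr hμ)
          (r.toFun i.1.1))
        hn (localMu F (toHeckeCharacter F μ))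
        (fun v x => norm_localMu F (toHeckeCharacter F μ) v (isUnitary_toHeckeCharacter F μ) x)
        (continuous_localMu F (toHeckeCharacter F μ))
        (fun v t => localMu_toLocalRing_eq_one_iff F (toHeckeCharacter F μ) v ((isOscillatorChar_toHeckeCharacter_iff μ).mpr hμ) t)
        i.1.2.1
        (Def411WeilCarriers.norm_chi_eq_one ↥(maximalRealSubfield F) F (IsCMField.complexConj F)
          (Algebra.IsQuadraticExtension.finrank_eq_two ↥(maximalRealSubfield F) F)
          (UnitaryGroup.algEquiv_ne_one_of_apply_eq_neg ↥(maximalRealSubfield F) F (IsCMField.complexConj F) (complexConj_imagUnit F)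
            (imagUnit_ne_zero F)) i.1.2)
        i.1.2.2.1 v)) :
    ((toThm418Data (sec42DataOf h isoOf F ι₁ V Φ) ((uniformOmegaRep h F ι₁ V Φ e dV hdV hdV0 ιV (2 * imagUnit F)⁻¹ (fun _ _ => r)).rest t)).rhoAt i).IsIrreducible :=
  Def411WeilCarriers.rhoAtLine_isIrreducible_of_lemD1AsPrinted ↥(maximalRealSubfield F) F (IsCMField.complexConj F) 3 e
    (Matrix.diagonal dV) (complexConj_imagUnit F) (imagUnit_ne_zero F) (imagUnit_mul_self F) (realDiagonal_isSymm F dV hdV)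
    (isUnit_det_realDiagonal F dV hdV hdV0) (realDiagonal_map F dV hdV).symm
    (OmegaChiSplitting.hsChiD F e dV hdV hdV0 (toHeckeCharacter F μ) (isUnitary_toHeckeCharacter F μ)
      ((isOscillatorChar_toHeckeCharacter_iff μ).mpr hμ))
    (r.toFun i.1.1) i.1.2
    (OmegaChiSplitting.chiLocalSplittingsD F e dV hdV hdV0 (toHeckeCharacter F μ) ((isOscillatorChar_toHeckeCharacter_iff μ).mpr hμ)
      (r.toFun i.1.1))
    (ι := ιV) hιs
    (OmegaChiSplitting.hfac_sChiD F e dV hdV hdV0 (toHeckeCharacter F μ) (isUnitary_toHeckeCharacter F μ)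
      ((isOscillatorChar_toHeckeCharacter_iff μ).mpr hμ) (r.toFun i.1.1))
    hn (localMu F (toHeckeCharacter F μ))
    (fun v x => norm_localMu F (toHeckeCharacter F μ) v (isUnitary_toHeckeCharacter F μ) x)
    (continuous_localMu F (toHeckeCharacter F μ))
    (fun v t => localMu_toLocalRing_eq_one_iff F (toHeckeCharacter F μ) v ((isOscillatorChar_toHeckeCharacter_iff μ).mpr hμ) t)
    hD1

/-- **`ω(μ, ε, χ) ≠ 0`** at the δ′ carriers over any tail — the Δ2 junction's `hnvD` shape (`Representation.IsIrreducible.nontrivial`).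
[cite: Liu2021, Def. 4.11 (FJcycle.tex l. 2094–2096), App. D Lemma D.1 (1) (l. 5229)] -/
theorem nontrivial_omegaAt_restAtDeltaPrimeTail_of_lemD1AsPrinted (h : exists_recordSystem) (F : CMField) [IsGalois ℚ F]
    (ι₁ : F →+* ℂ) (V : HermSpace3 F ι₁) (Φ : CMType F) {n : ℕ} (e : Fin 3 × Fin 1 ≃ Fin n) (dV : Fin 3 → F)
    (hdV : ∀ i, IsCMField.complexConj F (dV i) = dV i) (hdV0 : ∀ i, dV i ≠ 0)
    (ιV : (sec42DataOf h isoOf F ι₁ V Φ).G →*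
      UnitaryGroup.finAdelic ↥(maximalRealSubfield F) F (IsCMField.complexConj F) 3 (Matrix.diagonal dV))
    (r : Rep ↥(maximalRealSubfield F) (imagUnitSq F))
    (μ : Literature.NumberTheory.Automorphic.IdeleClassGroup F →ₜ* Circle) (hμ : IdeleClassGroup.IsConjugateSymplectic F μ)
    (t : RestTail (sec42DataOf h isoOf F ι₁ V Φ) μ hμ)
    (hιs : Function.Surjective ιV) (hn : 3 ≤ n)
    (i : (toThm418Data (sec42DataOf h isoOf F ι₁ V Φ) ((uniformOmegaRep h F ι₁ V Φ e dV hdV hdV0 ιV (2 * imagUnit F)⁻¹ (fun _ _ => r)).rest t)).AdmIndex)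
    (hD1 : ∀ v : HeightOneSpectrum (𝓞 ↥(maximalRealSubfield F)), LemD1_1AsPrinted
      (Def411WeilCarriers.localLemD1Data ↥(maximalRealSubfield F) F (IsCMField.complexConj F) 3 e (Matrix.diagonal dV)
        (complexConj_imagUnit F) (imagUnit_ne_zero F) (imagUnit_mul_self F) (realDiagonal_isSymm F dV hdV)
        (isUnit_det_realDiagonal F dV hdV hdV0) (realDiagonal_map F dV hdV).symm (r.toFun i.1.1)
        (OmegaChiSplitting.chiLocalSplittingsD F e dV hdV hdV0 (toHeckeCharacter F μ) ((isOscillatorChar_toHeckeCharacter_iff μ).mpr hμ)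
          (r.toFun i.1.1))
        hn (localMu F (toHeckeCharacter F μ))
        (fun v x => norm_localMu F (toHeckeCharacter F μ) v (isUnitary_toHeckeCharacter F μ) x)
        (continuous_localMu F (toHeckeCharacter F μ))
        (fun v t => localMu_toLocalRing_eq_one_iff F (toHeckeCharacter F μ) v ((isOscillatorChar_toHeckeCharacter_iff μ).mpr hμ) t)
        i.1.2.1
        (Def411WeilCarriers.norm_chi_eq_one ↥(maximalRealSubfield F) F (IsCMField.complexConj F)
          (Algebra.IsQuadraticExtension.finrank_eq_two ↥(maximalRealSubfield F) F)
          (UnitaryGroup.algEquiv_ne_one_of_apply_eq_neg ↥(maximalRealSubfield F) F (IsCMField.complexConj F) (complexConj_imagUnit F)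
            (imagUnit_ne_zero F)) i.1.2)
        i.1.2.2.1 v)) :
    Nontrivial ((toThm418Data (sec42DataOf h isoOf F ι₁ V Φ) ((uniformOmegaRep h F ι₁ V Φ e dV hdV hdV0 ιV (2 * imagUnit F)⁻¹ (fun _ _ => r)).rest t)).omegaAt i) :=
  haveI := rhoAt_restAtDeltaPrimeTail_isIrreducible_of_lemD1AsPrinted h F ι₁ V Φ e dV hdV hdV0 ιV r μ hμ t hιs hn i hD1
  Representation.IsIrreducible.nontrivial
    ((toThm418Data (sec42DataOf h isoOf F ι₁ V Φ) ((uniformOmegaRep h F ι₁ V Φ e dV hdV hdV0 ιV (2 * imagUnit F)⁻¹ (fun _ _ => r)).rest t)).rhoAt i)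

end Rest

section TransportHelpers

/-- the port's and the Literature's relation submodules of the `χ`-coinvariants are THE SAME submodule (twin definitions), for equal
characters. [folklore] -/
private theorem ker_twin_eq {k : Type*} [CommRing k] {H S : Type*} [Group H] [AddCommGroup S] [Module k S]
    (ρW : Representation k H S) {χ ψ : H →* kˣ} (hψ : ψ = χ) :
    HodgeCM.TwistedCoinv.ker ρW χ = Literature.RepresentationTheory.TwistedCoinv.ker ρW ψ := by
  subst hψ
  rfl

/-- on `ρ.asModule` the group-ring generator `of g` acts by `ρ g` (`Representation.asModuleEquiv_symm_map_rho`, the identification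
`asModuleEquiv` being the identity). [folklore] -/
private theorem of_smul_eq_asModule {k G W : Type*} [CommSemiring k] [Monoid G] [AddCommMonoid W] [Module k W]
    (ρ : Representation k G W) (g : G) (x : ρ.asModule) :
    MonoidAlgebra.of k G g • x = ρ.asModuleEquiv.symm (ρ g (ρ.asModuleEquiv x)) := by
  rw [Representation.asModuleEquiv_symm_map_rho, LinearEquiv.symm_apply_apply]

end TransportHelpers

/-! ## §2 One line, loose fields, any tail -/

section Line

set_option maxHeartbeats 4000000 in
-- (four `subst`s on local variables, then F4's witnesses inline; the `splittingDatum` telescope needs the budget of `omegaTransportAtDeltaPrime`)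
/-- **The Ω-pin at ONE index line (loose fields), over ANY tail `t`.**  For a line `(T_W′, J_W′)` EQUAL to the line of record `(T_W (r ε), J_W (r ε))` (`hT ∕ hJ`),
ANY compatible pair splitting `s` of the dual-pair datum at `(diag dV, J_W′)` EQUAL to the splitting `ι_{toHecke μ}` attached to `μ` (`hsEq`;
[GelbartRogawski1991, Remark p. 457]), ANY rest `R` EQUAL to the uniform δ′ rest `U.rest t` (`hR`), and a family `χof : Adm → (U(J_W′)(𝔸_f) →* ℂˣ)` of characters
with open kernels and trivial rational restrictions ([Liu2021, Def. 4.11] third bullet), injective: there are an INJECTIVE index map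
`σ : Adm → AdmIndex` (Def. 4.12's admissible index `(ε, χ ∘ centre)`, witness `(r ε)·(2δ_F)⁻¹`) and `ℂ`-linear isomorphisms
`e a : Ω(s, χof a)|_{ιV} ≃ ω(μ, ε, χof a ∘ centre) = (toThm418Data … R).omegaAt (σ a)` that are `𝔾(𝔸^∞)`-EQUIVARIANT (the identity on representatives).  At the `ι₁`-tail `hR` is ✔ `Model.restOfCharRep_eq_rest`.
[cite: Liu2021, Def. 4.11 (FJcycle.tex l. 2088–2096), Def. 4.12 (l. 2102–2108), Thm. 4.18 (l. 2232–2237), App. D §D.1 Steps 1–3 (l. 5215–5221)]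
[cite: GelbartRogawski1991, §3.1 Prop. 3.1.1 p. 455 L1–3, Remark p. 457 L4–13] -/
theorem exists_omegaPin_line_tail (h : exists_recordSystem) (F : CMField) [IsGalois ℚ F]
    (ι₁ : F →+* ℂ) (V : HermSpace3 F ι₁) (Φ : CMType F) {n : ℕ} (e : Fin 3 × Fin 1 ≃ Fin n) (dV : Fin 3 → F)
    (hdV : ∀ i, IsCMField.complexConj F (dV i) = dV i) (hdV0 : ∀ i, dV i ≠ 0)
    (ιV : (sec42DataOf h isoOf F ι₁ V Φ).G →*
      UnitaryGroup.finAdelic ↥(maximalRealSubfield F) F (IsCMField.complexConj F) 3 (Matrix.diagonal dV))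
    (r : Rep ↥(maximalRealSubfield F) (imagUnitSq F))
    (μ : Literature.NumberTheory.Automorphic.IdeleClassGroup F →ₜ* Circle)
    (hμ : Literature.NumberTheory.Automorphic.IdeleClassGroup.IsConjugateSymplectic F μ)
    (t : RestTail (sec42DataOf h isoOf F ι₁ V Φ) μ hμ)
    (R : Thm418Rest (sec42DataOf h isoOf F ι₁ V Φ)) (hR : (uniformOmegaRep h F ι₁ V Φ e dV hdV hdV0 ιV (2 * imagUnit F)⁻¹ (fun _ _ => r)).rest t = R)
    (ε : Eps ↥(maximalRealSubfield F) (imagUnitSq F)) (hε : ∃ a, locF ↥(maximalRealSubfield F) (imagUnitSq F) a = ε)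
    (hΦ : ∀ τ : F →+* ℂ, τ ∈ hμ.cmType.1 → 0 < (τ (imagUnit F * algebraMap ↥(maximalRealSubfield F) F (r.toFun ε))).im)
    (TW' : Matrix (Fin 1) (Fin 1) ↥(maximalRealSubfield F)) (JW' : Matrix (Fin 1) (Fin 1) F)
    (hW' : TW'.IsSymm) (hWd' : IsUnit TW'.det) (hJW' : JW' = TW'.map (algebraMap ↥(maximalRealSubfield F) F))
    (hT : TW ↥(maximalRealSubfield F) (r.toFun ε) = TW') (hJ : JW ↥(maximalRealSubfield F) F (r.toFun ε) = JW')
    (s : UnitaryGroup.adelicPair ↥(maximalRealSubfield F) F (IsCMField.complexConj F) 3 1 (Matrix.diagonal dV) JW' →*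
      adelicMpCont ↥(maximalRealSubfield F) (Fin n) (adelicGram ↥(maximalRealSubfield F) e (realDiagonal F dV hdV) TW'))
    (hs : (splittingDatum ↥(maximalRealSubfield F) F (IsCMField.complexConj F) 3 1 e (Matrix.diagonal dV) JW'
        (complexConj_imagUnit F) (imagUnit_ne_zero F) (imagUnit_mul_self F) (realDiagonal_isSymm F dV hdV) hW'
        (isUnit_det_realDiagonal F dV hdV hdV0) hWd' (realDiagonal_map F dV hdV).symm hJW').IsCompatible s)
    (hsEq : s = Def411WeilCarriersDoubling.chiSplittingLine F e dV hdV hdV0 (toHeckeCharacter F μ) (isUnitary_toHeckeCharacter F μ)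
        ((isOscillatorChar_toHeckeCharacter_iff μ).mpr hμ) TW' hWd' JW' hJW')
    {Adm : Type} (χof : Adm → (↥(UnitaryGroup.finAdelic ↥(maximalRealSubfield F) F (IsCMField.complexConj F) 1 JW') →* ℂˣ))
    (hGC : ∀ a : Adm,
      IsOpen (((χof a).ker : Subgroup _) : Set ↥(UnitaryGroup.finAdelic ↥(maximalRealSubfield F) F (IsCMField.complexConj F) 1 JW')) ∧
        ∀ γ : UnitaryGroup.rational ↥(maximalRealSubfield F) F (IsCMField.complexConj F) 1 JW',
          χof a (UnitaryGroup.rationalToFinAdelic ↥(maximalRealSubfield F) F (IsCMField.complexConj F) 1 JW' γ) = 1)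
    (hχof : Function.Injective χof) :
    ∃ (σ : Adm → (toThm418Data (sec42DataOf h isoOf F ι₁ V Φ) R).AdmIndex) (_ : Function.Injective σ)
      (e' : ∀ a : Adm, Representation.asModule
          ((HodgeCM.WeilCoinv.weilCoinv ↥(maximalRealSubfield F) F (IsCMField.complexConj F) 3 1 e (Matrix.diagonal dV) JW'
            (complexConj_imagUnit F) (imagUnit_ne_zero F) (imagUnit_mul_self F) (realDiagonal_isSymm F dV hdV) hW'
            (isUnit_det_realDiagonal F dV hdV hdV0) hWd' (realDiagonal_map F dV hdV).symm hJW' (χof a) hs).comp ιV) ≃ₗ[ℂ]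
        (toThm418Data (sec42DataOf h isoOf F ι₁ V Φ) R).omegaAt (σ a)),
      ∀ (a : Adm) (g : (sec42DataOf h isoOf F ι₁ V Φ).G) (m : Representation.asModule
          ((HodgeCM.WeilCoinv.weilCoinv ↥(maximalRealSubfield F) F (IsCMField.complexConj F) 3 1 e (Matrix.diagonal dV) JW'
            (complexConj_imagUnit F) (imagUnit_ne_zero F) (imagUnit_mul_self F) (realDiagonal_isSymm F dV hdV) hW'
            (isUnit_det_realDiagonal F dV hdV hdV0) hWd' (realDiagonal_map F dV hdV).symm hJW' (χof a) hs).comp ιV)),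
        e' a (MonoidAlgebra.of ℂ (sec42DataOf h isoOf F ι₁ V Φ).G g • m) =
          (toThm418Data (sec42DataOf h isoOf F ι₁ V Φ) R).rhoAt (σ a) g (e' a m) := by
  subst hR
  subst hsEq
  subst hJ
  subst hT
  refine ⟨fun a => ⟨(ε, chiAtLine F (r.toFun ε) _ rfl (χof a) (hGC a).1 (hGC a).2),
      ⟨algebraMap ↥(maximalRealSubfield F) F (r.toFun ε) * (2 * imagUnit F)⁻¹,
        isAdmissibleElement_mul_of_antiOriented F _ (r.toFun ε) _ (complexConj_inv_two_mul_imagUnit F)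
          (inv_two_mul_imagUnit_ne_zero F) (antiOriented_inv_two_mul_imagUnit F) hΦ,
        (Def411WeilCarriers.epsOf_algebraMap_mul ↥(maximalRealSubfield F) (imagUnitSq F) F _ (inv_two_mul_imagUnit_ne_zero F)
          (r.toFun ε)).trans (r.locF_toFun ε hε)⟩⟩, fun a b hab => ?_,
    fun a => Submodule.quotEquivOfEq _ _ (ker_twin_eq _ (lineChar_chiAtLine_self F (r.toFun ε) (χof a) (hGC a).1 (hGC a).2)),
    fun a g m => ?_⟩
  · -- `σ` is injective in `χ` (`chiAtLine_injective`), and `χof` is injective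
    exact hχof (chiAtLine_injective F (r.toFun ε) _ rfl (hGC a).1 (hGC a).2 (hGC b).1 (hGC b).2
      (Prod.ext_iff.1 (congrArg Subtype.val hab)).2)
  · -- the `ℂ[G]`-scalar `of g` acts on the package carrier through the representation; both sides are the class of the same function
    rw [of_smul_eq_asModule]
    obtain ⟨f, rfl⟩ := Submodule.Quotient.mk_surjective _ m
    rfl

end Line

/-! ## §3 The family form over per-line tails -/

section Family

set_option maxHeartbeats 2000000 in
/-- **THE Ω-PIN, FAMILY FORM, over per-line tails `t i hφ hg` — `σ ∕ hσ ∕ e ∕ he` EXIST at every good index line**, given per-line δ′-keys: the line's conjugate-symplectic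
weight-one Hecke character `μ_i`, a representative section `r_i` with the line-of-record equalities `hT ∕ hJ`, the global collection `ε_i` with
the orientation `hΦ` (`Φ_{μ_i}` δ-positive at `r_i ε_i`), the splitting identification `hsEq` (X3-Char at the line) and the rest of record `R i`
with `hR : (uniformOmegaRep … (fun _ _ ↦ r i hφ hg)).rest (t i hφ hg) = R i`.  Proof: `exists_omegaPin_line_tail` at every good line (`Classical.choice` inside the proof only).
[cite: Liu2021, Def. 4.11 (FJcycle.tex l. 2088–2096), Def. 4.12 (l. 2102–2108), Thm. 4.18 (l. 2232–2237), App. D §D.1 Steps 1–3 (l. 5215–5221)]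
[cite: GelbartRogawski1991, §3.1 Prop. 3.1.1 p. 455 L1–3, Remark p. 457 L4–13] -/
theorem exists_omegaPin_tail (h : exists_recordSystem) {L : HodgeCM.CMField} [IsGalois ℚ L]
    {ι₁ : L →+* ℂ} (V : HodgeCM.HermSpace3 L ι₁) (Φ : CMType L)
    (dV : Fin 3 → L) (hdV : ∀ i, IsCMField.complexConj L (dV i) = dV i) (hdV0 : ∀ i, dV i ≠ 0)
    (ιV : (sec42DataOf h isoOf ⟨L.K⟩ ι₁ ⟨V.Hm, V.isHermitian, V.signature_ι₁, V.posDef_of_ne⟩ Φ).G →*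
      UnitaryGroup.finAdelic ↥(maximalRealSubfield L) L (IsCMField.complexConj L) 3 (Matrix.diagonal dV))
    {Char : Type} (Adm : Char → Type)
    (line : Char → HodgeCM.Model.SplitLine (Matrix.diagonal dV) (realDiagonal L dV hdV) (complexConj_imagUnit L) (imagUnit_ne_zero L)
      (imagUnit_mul_self L) (realDiagonal_isSymm L dV hdV) (isUnit_det_realDiagonal L dV hdV hdV0) (realDiagonal_map L dV hdV).symm)
    (χof : (i : Char) → Adm i → (line i).CharW)
    (hGC : ∀ (i : Char) (a : Adm i),
      IsOpen (((χof i a).ker : Subgroup _) :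
        Set ↥(UnitaryGroup.finAdelic ↥(maximalRealSubfield L) L (IsCMField.complexConj L) 1 (line i).JW)) ∧
      ∀ γ : UnitaryGroup.rational ↥(maximalRealSubfield L) L (IsCMField.complexConj L) 1 (line i).JW,
        χof i a (UnitaryGroup.rationalToFinAdelic ↥(maximalRealSubfield L) L (IsCMField.complexConj L) 1 (line i).JW γ) = 1)
    (hχof : ∀ i : Char, Function.Injective (χof i))
    (PhiMu Good : Char → Prop)
    -- the per-line δ′-keys
    (r : ∀ i : Char, PhiMu i → Good i → Rep ↥(maximalRealSubfield L) (imagUnitSq L))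
    (μ : ∀ i : Char, PhiMu i → Good i → (Literature.NumberTheory.Automorphic.IdeleClassGroup L →ₜ* Circle))
    (hμ : ∀ (i : Char) (hφ : PhiMu i) (hg : Good i),
      Literature.NumberTheory.Automorphic.IdeleClassGroup.IsConjugateSymplectic L (μ i hφ hg))
    (t : ∀ (i : Char) (hφ : PhiMu i) (hg : Good i),
      RestTail (sec42DataOf h isoOf ⟨L.K⟩ ι₁ ⟨V.Hm, V.isHermitian, V.signature_ι₁, V.posDef_of_ne⟩ Φ) (μ i hφ hg) (hμ i hφ hg))
    (R : ∀ i : Char, PhiMu i → Good i → Thm418Rest (sec42DataOf h isoOf ⟨L.K⟩ ι₁ ⟨V.Hm, V.isHermitian, V.signature_ι₁, V.posDef_of_ne⟩ Φ))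
    (hR : ∀ (i : Char) (hφ : PhiMu i) (hg : Good i),
      (uniformOmegaRep h ⟨L.K⟩ ι₁ ⟨V.Hm, V.isHermitian, V.signature_ι₁, V.posDef_of_ne⟩ Φ (line i).e dV hdV hdV0 ιV (2 * imagUnit L)⁻¹
        (fun _ _ => r i hφ hg)).rest (t i hφ hg) = R i hφ hg)
    (ε : ∀ i : Char, PhiMu i → Good i → Eps ↥(maximalRealSubfield L) (imagUnitSq L))
    (hε : ∀ (i : Char) (hφ : PhiMu i) (hg : Good i), ∃ a, locF ↥(maximalRealSubfield L) (imagUnitSq L) a = ε i hφ hg)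
    (hΦ : ∀ (i : Char) (hφ : PhiMu i) (hg : Good i), ∀ τ : L →+* ℂ, τ ∈ (hμ i hφ hg).cmType.1 →
      0 < (τ (imagUnit L * algebraMap ↥(maximalRealSubfield L) L ((r i hφ hg).toFun (ε i hφ hg)))).im)
    (hT : ∀ (i : Char) (hφ : PhiMu i) (hg : Good i), TW ↥(maximalRealSubfield L) ((r i hφ hg).toFun (ε i hφ hg)) = (line i).TW)
    (hJ : ∀ (i : Char) (hφ : PhiMu i) (hg : Good i), JW ↥(maximalRealSubfield L) L ((r i hφ hg).toFun (ε i hφ hg)) = (line i).JW)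
    (hsEq : ∀ (i : Char) (hφ : PhiMu i) (hg : Good i),
      (line i).s = Def411WeilCarriersDoubling.chiSplittingLine L (line i).e dV hdV hdV0 (toHeckeCharacter L (μ i hφ hg))
        (isUnitary_toHeckeCharacter L (μ i hφ hg)) ((isOscillatorChar_toHeckeCharacter_iff (μ i hφ hg)).mpr (hμ i hφ hg))
        (line i).TW (line i).hWd (line i).JW (line i).hJW) :
    ∃ (σ : ∀ (i : Char) (hφ : PhiMu i) (hg : Good i),
        Adm i → (toThm418Data (sec42DataOf h isoOf ⟨L.K⟩ ι₁ ⟨V.Hm, V.isHermitian, V.signature_ι₁, V.posDef_of_ne⟩ Φ) (R i hφ hg)).AdmIndex)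
      (_ : ∀ (i : Char) (hφ : PhiMu i) (hg : Good i), Function.Injective (σ i hφ hg))
      (e : ∀ (i : Char) (hφ : PhiMu i) (hg : Good i) (a : Adm i), (line i).Ω ιV (χof i a) ≃ₗ[ℂ]
        (toThm418Data (sec42DataOf h isoOf ⟨L.K⟩ ι₁ ⟨V.Hm, V.isHermitian, V.signature_ι₁, V.posDef_of_ne⟩ Φ) (R i hφ hg)).omegaAt
          (σ i hφ hg a)),
      ∀ (i : Char) (hφ : PhiMu i) (hg : Good i) (a : Adm i) (g : ↥V.adelicFin) (m : (line i).Ω ιV (χof i a)),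
        e i hφ hg a (MonoidAlgebra.of ℂ ↥V.adelicFin g • m) =
          (toThm418Data (sec42DataOf h isoOf ⟨L.K⟩ ι₁ ⟨V.Hm, V.isHermitian, V.signature_ι₁, V.posDef_of_ne⟩ Φ) (R i hφ hg)).rhoAt
            (σ i hφ hg a) g (e i hφ hg a m) := by
  classical
  have key := fun (i : Char) (hφ : PhiMu i) (hg : Good i) =>
    exists_omegaPin_line_tail h ⟨L.K⟩ ι₁ ⟨V.Hm, V.isHermitian, V.signature_ι₁, V.posDef_of_ne⟩ Φ (line i).e dV hdV hdV0 ιV (r i hφ hg)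
      (μ i hφ hg) (hμ i hφ hg) (t i hφ hg) (R i hφ hg) (hR i hφ hg) (ε i hφ hg) (hε i hφ hg) (hΦ i hφ hg) (line i).TW (line i).JW
      (line i).hW (line i).hWd (line i).hJW (hT i hφ hg) (hJ i hφ hg) (line i).s (line i).hs (hsEq i hφ hg) (χof i) (hGC i) (hχof i)
  choose σ hσ e' he using key
  exact ⟨σ, hσ, e', he⟩

end Family

/-! ## §4 The one-object tail presented at any `σ` -/

section Tails

/-- **`𝒜(μ) ≠ ∅` for the one-object tail PRESENTED AT ANY `σ : F →+* ℂ`** (in particular at `ῑ₁`), from `h21` ([Shimura1998] Thm. 21.4 via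
`Def45.nonempty_cmDatum_polDR_rMuForm_of_casselman`, σ-generic). [cite: Liu2021, Prop. 4.6 (1) (FJcycle.tex l. 1969)] [cite: Shimura1998, §21.4 Thm. 21.4] -/
theorem nonempty_obj_rest_restTailOne (h : exists_recordSystem) (F : CMField) [IsGalois ℚ F] (h6 : 6 ≤ Module.finrank ℚ F)
    (ι₁ : F →+* ℂ) (V : HermSpace3 F ι₁) (Φ : CMType F) {n : ℕ} (e : Fin 3 × Fin 1 ≃ Fin n) (dV : Fin 3 → F)
    (hdV : ∀ i, IsCMField.complexConj F (dV i) = dV i) (hdV0 : ∀ i, dV i ≠ 0)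
    (ιV : (sec42DataOf h isoOf F ι₁ V Φ).G →*
      UnitaryGroup.finAdelic ↥(maximalRealSubfield F) F (IsCMField.complexConj F) 3 (Matrix.diagonal dV))
    (r : Rep ↥(maximalRealSubfield F) (imagUnitSq F))
    (μ : Literature.NumberTheory.Automorphic.IdeleClassGroup F →ₜ* Circle) (hμ : IdeleClassGroup.IsConjugateSymplectic F μ) (hw : IdeleClassGroup.HasWeight F μ 1)
    (σ : F →+* ℂ) (h21 : shimura1998_thm21_4_casselman) :
    Nonempty (toThm418Data (sec42DataOf h isoOf F ι₁ V Φ)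
      ((uniformOmegaRep h F ι₁ V Φ e dV hdV hdV0 ιV (2 * imagUnit F)⁻¹ (fun _ _ => r)).rest
        (restTailOne (AlgHom.id ℚ F) σ hμ hw (Def45.Carriers.ofPolDR μ (Def45.PolDR σ hμ (Def45.RMuForm σ hμ)))
          ((heckeTranslatesFamilyOf heckeTranslate_definedOver_holds h isoOf F ι₁ V Φ h6).rhoΩOne (AlgHom.id ℚ F) σ hμ hw
            (Def45.Carriers.ofPolDR μ (Def45.PolDR σ hμ (Def45.RMuForm σ hμ))))))).Obj :=
  (nonempty_obj_restOne_iff _ _ _ _ _ _ _ _ _ _ _ _).mpr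
    (Def45.nonempty_cmDatum_polDR_rMuForm_of_casselman (σ := σ) (hμ := hμ) hw h21)

end Tails

end Summit.HodgeConjecture.CorCM.Model

end
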